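import Summits.BirchSwinnertonDyer.BirchSwinnertonDyer.Theorems.Rank2Observatory2DescClRealKillCertE2V
import HarnessLib

/-!
# BirchSwinnertonDyer — rank ≥ 2 observatory: KERNEL-2DESC-CL v3.7, RE2V — TOTALLY REAL two-view (η-family) certificates with a kill list in VALIDITY form, part 3/3: row shapes

HONEST FRAMING: per-curve certified theorems and census instruments; no claim on BSD in rank ≥ 2.

The `K`-free row shapes over the model `CubicField a b c` for the totally real two-view certificate with a kill list in validity
form: `rank_eq_of_certsE2RKV`, `_scaled`, `_complSq`, `_plain` — the v2.7 shapes `rank_eq_of_certsE2RK…` (`…ClRealKillCertE2Rows`)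
with the checker `checkE2RKV` and the proposition `KillValidE2 G.toE2 ccr.cc ks` (assembled per row by `killValidE2_cons/_nil` of
the complex rows file `…ClKillCurveCertE2VRows`, one validity per kill from ANY certificate: `killValidAt_of_killCheck`,
`killValidAt_of_l2Check`, `qkCert_sound`, `conicCert_sound`, …).  A row reads `rank_eq_of_certsE2RKV_plain 2 <G> <ccr> <G>.check2R
<G>.primes [⟨U, p, fuel⟩, …] (by decide +kernel) <hk> a₂ a₄ a₆ ⟨rfl, rfl, rfl⟩ <lower bound>`.  Text = the RE2K file by
`generics/e2v/tools/mk_re2v.py`.  New declarations only; sorry-free.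
[cite: Cassels1991LecturesEllipticCurves, §15] [cite: CremonaAlgorithms1997, §3.6] [cite: Cohen1993, §4.8.2, §6.2, §6.5]
[cite: Marcus2018, Ch. 5, Thm. 38] [cite: SilvermanAEC2009, X.1.1]
-/

set_option linter.dupNamespace false

noncomputable section

open Polynomial NumberField IsDedekindDomain Module
open Literature.NumberTheory.NumberFields   -- OPENFIX (cert-1 gen 35): `MonicCubic.*` lives in this namespace; the line was missing (inlined-head prechecks leaked it from `…ClRealCertE`)

namespace Summit.BirchSwinnertonDyer.BirchSwinnertonDyer.Rank2Observatory.TwoDescCl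

open TwoDescCubic ClFieldCert

/-! ## `K`-free wrappers over the model `CubicField a b c` -/
section Rows

/-- **`rank E(ℚ) = r` from the two records** (model `(0, A, 0, B, C)`, totally real two-view field with multipliers).
[cite: Cassels1991LecturesEllipticCurves, §15] [cite: CremonaAlgorithms1997, §3.6] -/
theorem rank_eq_of_certsE2RKV (r : ℕ) (G : ClFieldCertRE2) (ccr : ClCurveCertE2R) (h2 : G.check2R = true)
    (hpr : G.toE2.fe.primeListE.Forall Nat.Prime) (ks : List ClKillE2) (hc : checkE2RKV G ccr r ks = true)
    (hk : KillValidE2 G.toE2 ccr.cc ks)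
    (hlow : r ≤ (((⟨0, ccr.cc.A, 0, ccr.cc.B, ccr.cc.C⟩ : WeierstrassCurve ℤ)).map
      (Int.castRingHom ℚ)).mordellWeilRank) :
    (((⟨0, ccr.cc.A, 0, ccr.cc.B, ccr.cc.C⟩ : WeierstrassCurve ℤ)).map (Int.castRingHom ℚ)).mordellWeilRank =
      r := by
  haveI : Fact (Irreducible (MonicCubic.polyQ G.toE2.fe.base.a G.toE2.fe.base.b G.toE2.fe.base.c)) :=
    ⟨G.toE2.fe.base.irreducible_of_reg (G.toE2.fe.checkReg_of_coreE (G.checkCoreE_of_check2R h2))⟩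
  exact rank_eq_of_checkE2RKV (K := CubicField G.toE2.fe.base.a G.toE2.fe.base.b G.toE2.fe.base.c) r G
    (CubicField.aeval_root _ _ _) (CubicField.finrank_eq _ _ _) h2 hpr ccr ks hc hk hlow

/-- **`rank E(ℚ) = r` for the ORIGINAL model** `(a₁, a₂, a₃, a₄, a₆)` when the records certify its
completed-square model RESCALED by `d` — `(0, d²(a₁² + 4a₂), 0, 8d⁴(a₁a₃ + 2a₄), 16d⁶(a₃² + 4a₆))` — (rank is
invariant under both variable changes; `d = 1` is the plain completed square). [cite: CremonaAlgorithms1997, §3.6]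
[cite: SilvermanAEC2009, III.3.1(b)] -/
theorem rank_eq_of_certsE2RKV_scaled (r : ℕ) (G : ClFieldCertRE2) (ccr : ClCurveCertE2R) (h2 : G.check2R = true)
    (hpr : G.toE2.fe.primeListE.Forall Nat.Prime) (ks : List ClKillE2) (hc : checkE2RKV G ccr r ks = true)
    (hk : KillValidE2 G.toE2 ccr.cc ks) (a₁ a₂ a₃ a₄ a₆ d : ℤ)
    (hd : d ≠ 0)
    (hABC : ccr.cc.A = d ^ 2 * (a₁ ^ 2 + 4 * a₂) ∧ ccr.cc.B = d ^ 4 * (8 * (a₁ * a₃ + 2 * a₄)) ∧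
      ccr.cc.C = d ^ 6 * (16 * (a₃ ^ 2 + 4 * a₆)))
    (hlow : r ≤ (((⟨a₁, a₂, a₃, a₄, a₆⟩ : WeierstrassCurve ℤ)).map (Int.castRingHom ℚ)).mordellWeilRank) :
    (((⟨a₁, a₂, a₃, a₄, a₆⟩ : WeierstrassCurve ℤ)).map (Int.castRingHom ℚ)).mordellWeilRank = r := by
  obtain ⟨hA, hB, hC⟩ := hABC
  -- completed square
  have hV : ((⟨0, a₁ ^ 2 + 4 * a₂, 0, 8 * (a₁ * a₃ + 2 * a₄), 16 * (a₃ ^ 2 + 4 * a₆)⟩ : WeierstrassCurve ℤ)).map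
        (Int.castRingHom ℚ) =
      (⟨Units.mk0 (1 / 2 : ℚ) (by norm_num), 0, -(a₁ : ℚ) / 2, -(a₃ : ℚ) / 2⟩ :
        WeierstrassCurve.VariableChange ℚ) •
        (((⟨a₁, a₂, a₃, a₄, a₆⟩ : WeierstrassCurve ℤ)).map (Int.castRingHom ℚ)) := by
    ext <;> simp only [WeierstrassCurve.map_a₁, WeierstrassCurve.map_a₂, WeierstrassCurve.map_a₃,
      WeierstrassCurve.map_a₄, WeierstrassCurve.map_a₆, WeierstrassCurve.variableChange_a₁,
      WeierstrassCurve.variableChange_a₂, WeierstrassCurve.variableChange_a₃,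
      WeierstrassCurve.variableChange_a₄, WeierstrassCurve.variableChange_a₆, Units.val_inv_eq_inv_val,
      Units.val_mk0, eq_intCast, Int.cast_zero] <;> push_cast <;> ring
  have hr₁ : (((⟨0, a₁ ^ 2 + 4 * a₂, 0, 8 * (a₁ * a₃ + 2 * a₄), 16 * (a₃ ^ 2 + 4 * a₆)⟩ : WeierstrassCurve ℤ)).map
        (Int.castRingHom ℚ)).mordellWeilRank =
      (((⟨a₁, a₂, a₃, a₄, a₆⟩ : WeierstrassCurve ℤ)).map (Int.castRingHom ℚ)).mordellWeilRank := by
    rw [hV]; exact WeierstrassCurve.mordellWeilRank_variableChange_holds _ _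
  -- rescaling
  have hS : scaleModel (⟨0, a₁ ^ 2 + 4 * a₂, 0, 8 * (a₁ * a₃ + 2 * a₄), 16 * (a₃ ^ 2 + 4 * a₆)⟩ :
      WeierstrassCurve ℤ) d = ⟨0, ccr.cc.A, 0, ccr.cc.B, ccr.cc.C⟩ := by
    simp only [scaleModel, hA, hB, hC, mul_zero]
  have hr₂ := mordellWeilRank_scaleModel
    (⟨0, a₁ ^ 2 + 4 * a₂, 0, 8 * (a₁ * a₃ + 2 * a₄), 16 * (a₃ ^ 2 + 4 * a₆)⟩ : WeierstrassCurve ℤ) hd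
  rw [hS] at hr₂
  rw [← hr₁, ← hr₂] at hlow ⊢
  exact rank_eq_of_certsE2RKV r G ccr h2 hpr ks hc hk hlow

/-- The plain completed-square shape (`d = 1`). [cite: CremonaAlgorithms1997, §3.6] -/
theorem rank_eq_of_certsE2RKV_complSq (r : ℕ) (G : ClFieldCertRE2) (ccr : ClCurveCertE2R) (h2 : G.check2R = true)
    (hpr : G.toE2.fe.primeListE.Forall Nat.Prime) (ks : List ClKillE2) (hc : checkE2RKV G ccr r ks = true)
    (hk : KillValidE2 G.toE2 ccr.cc ks) (a₁ a₂ a₃ a₄ a₆ : ℤ)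
    (hABC : ccr.cc.A = a₁ ^ 2 + 4 * a₂ ∧ ccr.cc.B = 8 * (a₁ * a₃ + 2 * a₄) ∧ ccr.cc.C = 16 * (a₃ ^ 2 + 4 * a₆))
    (hlow : r ≤ (((⟨a₁, a₂, a₃, a₄, a₆⟩ : WeierstrassCurve ℤ)).map (Int.castRingHom ℚ)).mordellWeilRank) :
    (((⟨a₁, a₂, a₃, a₄, a₆⟩ : WeierstrassCurve ℤ)).map (Int.castRingHom ℚ)).mordellWeilRank = r :=
  rank_eq_of_certsE2RKV_scaled r G ccr h2 hpr ks hc hk a₁ a₂ a₃ a₄ a₆ 1 one_ne_zero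
    (by obtain ⟨hA, hB, hC⟩ := hABC; exact ⟨by rw [hA]; ring, by rw [hB]; ring, by rw [hC]; ring⟩) hlow

/-- Row plumbing for a curve already given by a plain model `y² = x³ + a₂x² + a₄x + a₆` (`a₁ = a₃ = 0`): the record's
cubic IS the curve. [cite: Cassels1991LecturesEllipticCurves, §15] -/
theorem rank_eq_of_certsE2RKV_plain (r : ℕ) (G : ClFieldCertRE2) (ccr : ClCurveCertE2R) (h2 : G.check2R = true)
    (hpr : G.toE2.fe.primeListE.Forall Nat.Prime) (ks : List ClKillE2) (hc : checkE2RKV G ccr r ks = true)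
    (hk : KillValidE2 G.toE2 ccr.cc ks) (a₂ a₄ a₆ : ℤ)
    (hABC : ccr.cc.A = a₂ ∧ ccr.cc.B = a₄ ∧ ccr.cc.C = a₆)
    (hlow : r ≤ (((⟨0, a₂, 0, a₄, a₆⟩ : WeierstrassCurve ℤ)).map (Int.castRingHom ℚ)).mordellWeilRank) :
    (((⟨0, a₂, 0, a₄, a₆⟩ : WeierstrassCurve ℤ)).map (Int.castRingHom ℚ)).mordellWeilRank = r := by
  obtain ⟨rfl, rfl, rfl⟩ := hABC
  exact rank_eq_of_certsE2RKV r G ccr h2 hpr ks hc hk hlow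

end Rows

end Summit.BirchSwinnertonDyer.BirchSwinnertonDyer.Rank2Observatory.TwoDescCl

end
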